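import Mathlib
import HarnessLib
import Summits.Langlands.Langlands.Theses.MaassFreeConverse
import Literature.NumberTheory.Automorphic.GLnAdelicStructureProofs

/-!
# MaassFreeConverse — proof of the glue `CriterionDescent` (stmt-Langlands-14446)

`CriterionDescent : CriticalValuesBettiRational → AlgebraicRelationsDecide → RegularInsolubleDescent`
(route-Langlands-MaassFreeConverse, binder `hG` of its deciding theorem
`closes … := hJ (hG hB hD)`): the two cruxes imply the route's target.

Proof (the route header's recipe, rev 5): fix `ρ` in the regular admissible sector with its
cuspidal avatar `P` over `F`.  `CriticalValuesBettiRational` yields a level `N ≥ 1`, a finite set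
`S` of places, a Satake family `α` matching `ρ` off `S`, and the clause «every criterion datum whose
relations are killed by all genuine level-`N` cusp forms (NECESSITY) is killed by `α` too».
`AlgebraicRelationsDecide`, fed the PROVED compactness of the integral finite levels
(`isCompact_glFiniteIntegralLevel_holds`, Literature), yields a VALID datum `(s₀, D_even, D_odd, δ, R)`:
algebraic ∧ NECESSITY ∧ CONVERSE.  The clause applied to NECESSITY gives bad-factor data `γ` with
which `α` kills `R`; CONVERSE then produces a cuspidal `π` over `ℚ` of the right infinity type whose
Satake parameters are `α v` for almost every `v`; intersecting with the cofinite complement of `S`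
gives Satake–Frobenius compatibility of `π` with `ρ` almost everywhere.  Pure logic over the two
cruxes; no definition, no named unproved fact as a hypothesis, no `sorry`.
References: A. Raghuram, *On the special values of certain Rankin–Selberg L-functions and
applications to odd symmetric power L-functions of modular forms*, IMRN 2010 [Raghuram2009];
K. Buzzard, T. Gee, *The conjectural connections between automorphic representations and Galois
representations*, LMS Lecture Notes 414 (2014) [BuzzardGeeLMS2014].
-/

set_option linter.dupNamespace false

namespace Summit.Langlands.Langlands.Theorems.MaassFreeConverseCriterionDescent

open Filter
open Literature.NumberTheory.Automorphic
open Summit.Langlands.Langlands.Theses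
open Summit.Langlands.Langlands.Theses.MaassFreeConverse

/-- **`CriterionDescent` holds** (stmt-Langlands-14446, proved outright): the cocycle-identity crux
`CriticalValuesBettiRational` and the Maass-free converse theorem `AlgebraicRelationsDecide` imply
the route's target `RegularInsolubleDescent` — level/Satake data from the first, a valid criterion
datum from the second at the proved compactness facts, `γ` from NECESSITY, `π` from CONVERSE, and a
cofinite intersection. [folklore] -/
theorem criterionDescent_proof :
    Summit.Langlands.Langlands.Theses.MaassFreeConverse.CriterionDescent := by
  intro hB hD m hm ℓ _ ι ρ wt F _ _ hF P hirr hadm hinf hcomp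
  obtain ⟨N, S, α, hN, hcard, hρ, hclause⟩ := hB m hm ℓ ι ρ wt F hF P hirr hadm hinf hcomp
  have hc : ∀ j : ℕ, isCompact_glFiniteIntegralLevel j ℚ := fun j =>
    isCompact_glFiniteIntegralLevel_holds j ℚ
  obtain ⟨s₀, De, Do, δ, R, -, hnec, hconv⟩ := hD m hm N hN wt hadm hc
  obtain ⟨γ, hkill⟩ := hclause hc s₀ De Do δ R hnec
  obtain ⟨π, hπinf, hπsat⟩ := hconv α γ hcard hkill
  refine ⟨hc (m + 1), π, hπinf.1, ?_⟩
  filter_upwards [hπsat, S.eventually_cofinite_notMem] with v hv hvS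
  exact ⟨α v, hv, hρ v hvS⟩

end Summit.Langlands.Langlands.Theorems.MaassFreeConverseCriterionDescent
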